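import Summits.QuantumFields.YangMills.Theorems.BalabanUVNodesN12ClassLettersAtClosedClassOfRecord
import Literature.MathematicalPhysics.QuantumFieldTheory.Balaban1983to89.Node00.MultiScaleFibreChartB
import Summits.QuantumFields.YangMills.Theorems.BalabanUVNodesN12ClassLetterTowerContinuityB
import HarnessLib

/-!
# BalabanUVNodes ∕ N12 — THE CLASS LETTERS OF THE w1 LINEAGE's CHART THEOREM, PART 2: AT THE CLOSED READING OF NODE 00's (2.12) CLASS — **BOND-DATUM EDITION** (`…N12ClassLettersAtClosedClassOfRecordB`, USED DECLARATIONS ONLY)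

The print-datum ([Balaban1984PropagatorsII] (2.3)) (γ) twin of `Summits/…/Theorems/BalabanUVNodesN12ClassLettersAtClosedClassOfRecord.lean`: the declarations of the parent whose STATEMENT reads the determining datum
(`classLetters_closure_regMSCoPOfRecord_of_coneBoxes`, `continuousOn_constrainedAverages_closure_regMSCoPOfRecordAt_of_coneBoxes`, `continuousOn_constrainedAverages_closure_regMSCoPOfRecord_of_coneBoxes`) and which N12's junction of record v14ᴸ uses (dag-n12-c g35 probe-2 census `UsedConstsN12RoadTyped2`, THEOREMS block), re-typed over a
BOND-LEVEL datum `𝔅 : BDetSet` (F0a `B15DeterminingSetsB`) and dag-n12-c's bond-datum chart `Node00.msChartB` (✓p774329; `msChart 𝐁 = msChartB (bondsDet 𝐁)` by `rfl`).  GENERATOR twin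
(this seat's `work/g32/gen_thm.py`, block-extracted from the parent's tree bytes): namespace `…N12ClassLettersAtClosedClassOfRecordB`, SAME short names, `DetSet ↦ BDetSet`, `AgreeOn 𝐁 ↦ AgreeOnB 𝔅`,
`IsMinimizer ↦ IsMinimizerB`, `bondsOf (𝐁 j) ↦ 𝔅 j`, `msChart ∕ constrCard ∕ constrEnum ∕ ConstrSet ↦ …B`, NODE 00 chart lemmas `…msChart… ↦ …msChartB…`; proofs VERBATIM; the parent's
datum-free declarations REUSED BY NAME (`open`), never copied (private plumbing excepted, №366 R2).  The parent's (b) statements are the instances `𝔅 := bondsDet 𝐁`.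

Cell `pub-ymgap` (HUMAN RULINGS D-0062 ∕ D-0149), seat `pub-ymgap-dag-n12-d` g32 (R134 N12 [B15] s2; the (ii) Theorems-side re-key of N12's road at print's [II] (2.3) datum — director-ym №338 ∕
№343 (E1)(iii-b), FLAG №16 ∕ ruling (α); dag-n12-c DESIGN memo a793b2ebc0b803bf (ii); `N12-ROAD-TWIN-ORDER-2026-08-30.md`).  Count-neutral helper of K1⁹ `stmt-QuantumFields-27364`,
`--kind proof --supports … --as helper`.  THEOREMS ONLY (0 `def`, 0 `instance`, 0 `sorry`).

HONEST FRAMING (director-ym №338 (5)).  PURELY ADDITIVE: the parent stays landed and true on its own text; nothing in it is edited; no displayed premise of any consumer is deleted or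
weakened; every hypothesis of the parent stays a hypothesis.  Nothing of Bałaban's analysis asserted; N12 NOT discharged; K0⁷ ∕ K1⁹ NOT closed; counts unmoved (typed 28∕28 · discharged
8∕27, A 8∕28; K 1∕4); one finite 𝕋⁴ programme at fixed ε — R4 closes the conditional rung `BalabanLadder.UV` only; NOT the Yang–Mills mass gap (Clay); nothing continuum ∕ ℝ⁴ ∕ OS.

PARENT's DOCSTRING (the mathematics and the citations; read the site-level `𝐁` as the bond datum `𝔅`):
# BalabanUVNodes ∕ N12 — THE CLASS LETTERS OF THE w1 LINEAGE's CHART THEOREM, PART 2: AT THE CLOSED READING OF NODE 00's (2.12) CLASS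
# ([Balaban1985Variational] (2), (6)–(7) pp. 278–279; [Balaban1985RegularSpaces] (1.7) p. 77; [Balaban1985Averaging] Prop. 2 (52)–(54) p. 26; [Balaban1988Convergent] (2.12) p. 256)

Cell `pub-ymgap` (HUMAN RULINGS D-0062 ∕ D-0149), WIDTH SEAT `pub-ymgap-dag-n12-w1` g4 (node N12 = [B15]; key K1⁹ `stmt-QuantumFields-27364`, `--kind proof --supports … --as helper`;
count-neutral).  THEOREMS ONLY (0 `def`, 0 `instance`, 0 `sorry`); consumed BY NAME: Part 1 (`…N12ClassLetterTowerContinuity`), NODE 00's class `Node00.regMSCoPOfRecordAt` ∕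
`regMSCoPOfRecord` (`Node00/LargeFieldBackgroundCoPOfRecord`, node00-def-R), dag-n07-e's `…N07DirectMethod.continuous_dist1_plaqHol`.

WHY.  The lineage's chart theorems `B15Prop1MinimiserFamilyFromThm1AtBaseCentral.hMin_atRecord_of_node00Letters_thm1AtBase_central` (p631475) ∕ `…N12RightInverseLetterOfForest.…_central_surj`
(p633254) take a closed reading class `reg'` of NODE 00's STRICT (2.12) class `reg = Node00.regMSCoPOfRecord F 2 ν Kt kc Ω` with three letters: `hreg' : IsClosed reg'`,
`hcl : closure reg ⊆ reg'`, `hDreg' : ContinuousOn (fun U i => ↑(Ū U)_{(j_i,c_i)}) reg'`; print's Theorem 1 at the base datum, (T1@q₀), is then quantified over `reg'`, so the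
consumer wants `reg'` as SMALL as possible.  THIS FILE takes the smallest admissible one, `reg' := closure reg`, for which `hreg'` and `hcl` are trivial, and discharges `hDreg'` from
Part 1 modulo ONE combinatorial geometry letter and k-INDEPENDENT numerics on `ν.εreg`: the closure of the strict class lies in its closed (≤) (1.7)-companion (§1–§2); a member of
the closed companion has its fine plaquettes within `εreg·η_{j′}²` on `plaqsOf (topSeq Ω₀ Ω j′)`, hence within `2L²εreg·η_j²` on any plaquette set lying in the levels `j′ ≥ j − 1`
(§3: the base collar of the tower under a level-`j` constrained bond may straddle `Ω_j` and `Ω_{j−1}∖Ω_j`); Part 1 (dag-n11-d's LOCAL [B7] Prop. 2 + the (0.4) guard + dag-n07-e's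
continuity brick down the tower) then gives continuity at every point of the closure (§4).

THE GEOMETRY LETTER `hgeom` (displayed, per constrained bond `(j, c)` of `𝐁`, `j ≤ k`): a bond family `B` through `c` closed downward under the (0.4) window below `j`, a plaquette
family `S` containing the three blocks of every `B`-bond and box-closed below `j` (dag-n20-d's one-step boxes of radius `(d+4)L + 2`), whose fine member `S 0` lies in
`⋃_{j′ ≤ kc, j ≤ j′+1} plaqsOf (topSeq Ω₀ Ω j′)`.  At the record (`𝐁 = Bj ν.M₁ Z k`, `Ω = maxDomT ν.M₁ Z`, [III] (2.13)) it is lattice geometry of the (2.2) cubes and the (2.13)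
separation (the tower base collar of a `Γ_j`-cube — about `(d+6)` level-`j` blocks around it — must lie in `Ω_{j−1}`); NOT inhabited here.

CONTENTS.  §1 `isClosed_setOf_forall_plaqLeOn` · §2 `closure_regMSCoPOfRecordAt_subset_plaqLe`, `dist1_plaqHol_le_of_mem_closure_regMSCoPOfRecordAt` · §3 `eta_le_L_mul_eta`,
★ `plaqSmallOn_of_mem_closure_regMSCoPOfRecordAt_of_subset_levels` · §4 ★★★ `continuousOn_constrainedAverages_closure_regMSCoPOfRecordAt`, ★★★ `…_regMSCoPOfRecord` (the support of
record), ★★★ `classLetters_closure_regMSCoPOfRecord` (the TRIPLE in the binder order of E″∕I).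

HONEST FRAMING.  Point-set topology and bookkeeping over Part 1 and NODE 00's definitions; the geometry letter and the numerics are DISPLAYED; nothing of Bałaban's estimates asserted
beyond the tree's kernel theorems; N12 NOT discharged; K1⁹ NOT closed; counts unmoved; one finite 𝕋⁴ programme at fixed ε — R4 closes the conditional rung `BalabanLadder.UV` only; the
Yang–Mills mass gap (Clay) is NOT proved by any of this; nothing continuum ∕ ℝ⁴ ∕ OS.
-/

noncomputable section

namespace Summit.QuantumFields.YangMills.BalabanUVNodes.N12ClassLettersAtClosedClassOfRecordB

open Literature.MathematicalPhysics.QuantumFieldTheory.Balaban1983to89.B15DeterminingSetsB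

open Set Filter Topology
open Literature.MathematicalPhysics.QuantumFieldTheory.Balaban1983to89
open Literature.MathematicalPhysics.QuantumFieldTheory.Balaban1983to89.T4Continuum (T4Family)
open Literature.MathematicalPhysics.QuantumFieldTheory.Balaban1983to89.Node00
open Literature.MathematicalPhysics.QuantumFieldTheory.Balaban1983to89.BlockAveraging (blockAvg Small)
open Literature.MathematicalPhysics.QuantumFieldTheory.Balaban1983to89.ExpMeanLog (expMeanLogSU deltaSU)
open Literature.MathematicalPhysics.QuantumFieldTheory.Balaban1983to89.B15DeterminingSets (DetSet MSField avgFamily bondsOf)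
open Literature.MathematicalPhysics.QuantumFieldTheory.Balaban1983to89.B8Eq17ClassAkV1 (plaqsOf)
open Summit.QuantumFields.YangMills.BalabanUVNodes.N07DirectMethod (continuous_dist1_plaqHol)
open Summit.QuantumFields.YangMills.BalabanUVNodes.N12ClassLetterTowerContinuity (small_iter_of_plaqSmallOn_boxClosed stokes_two_mul_lt_deltaSU)
open Summit.QuantumFields.YangMills.BalabanUVNodes.N12ClassLetterTowerContinuityB (continuousOn_constrainedAverages_of_towerGuards)
open Summit.QuantumFields.YangMills.Theorems.N21LocalAveragedRegularity (plaqSmallOn_iter_avOfRecord_loc)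
open Summit.QuantumFields.YangMills.Theorems.LocalSmallLoop (mem_boxRegion_of_blockOf_near)
open Literature.MathematicalPhysics.QuantumFieldTheory.Balaban1983to89.BlockAveragingPlaquetteBoundLocal (small_of_plaqSmallOn_blocks)
open Summit.QuantumFields.YangMills.BalabanUVNodes.N20LCSAvgDominationRegion (boxRegion)
open scoped Matrix.Norms.L2Operator
open Summit.QuantumFields.YangMills.BalabanUVNodes.N12ClassLettersAtClosedClassOfRecord (continuousOn_constrainedAverages_closure_regMSCoPOfRecordAt eta_le_eta_of_le plaqSmallOn_of_mem_closure_regMSCoPOfRecordAt_of_subset_levels small_iter_of_plaqSmallOn_coneBox)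

section
variable {F : T4Family} {N : ℕ} [NeZero N] {K : ℕ}

/-- ★★★ **`hDreg'` AT THE CLOSURE OF NODE 00's CLASS ON A SUPPORT, CONE-BOX PACKAGING**: as `continuousOn_constrainedAverages_closure_regMSCoPOfRecordAt`, with the geometry letter
asking, per constrained bond `(j, c)`, a bond family `B ∋ c` closed downward under the (0.4) window below `j` and, for every `c′ ∈ B (i+1)`, `i + 1 ≤ j`, a chain of block centres below
`emb c′₋` whose bottom fine box `boxRegion (xs 0) (Lⁱ(2L + (d+4)L + 2))` lies in the levels `j′ ≤ kc`, `j ≤ j′ + 1` of the class (no box-closed plaquette family).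
[cite: Balaban1985Variational, (2), (6)–(7) pp.278–279, (16)–(18) p.280; Balaban1985Averaging, Prop. 2 (52)–(54) p.26; Balaban1987RG1, (0.4) p.253; Balaban1988Convergent, (2.10)–(2.13) pp.256–257] -/
theorem continuousOn_constrainedAverages_closure_regMSCoPOfRecordAt_of_coneBoxes (ν : Stage7Numerics) (hε : 0 < ν.εreg) {k : ℕ}
    (hk : k ≤ (F.P K).m + (F.P K).K) (kc : ℕ) (Ω₀ : Set (Site (F.P K) 0)) (Ω : ℕ → Set (Site (F.P K) 0)) (𝔅 : BDetSet (F.P K))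
    (hα3 : (143 * (((((F.P K).d + 4 : ℕ) : ℝ)) ^ 2 / 4) ^ 2) * (2 * ((F.P K).L : ℝ) ^ 2 * ν.εreg) ≤ 1 / 3)
    (hα2 : 2 * (2 * ((F.P K).L : ℝ) ^ 2 * ν.εreg) ≤ 2 * deltaSU (Fin N) / ((((F.P K).d + 4) * (F.P K).L : ℕ) : ℝ) ^ 2)
    (hgeom : ∀ j, j ≤ k → ∀ c ∈ (𝔅 j), ∃ B : (i : ℕ) → Set (PBond (F.P K) i), c ∈ B j ∧
      (∀ (i : ℕ) (c' : PBond (F.P K) (i + 1)), i + 1 ≤ j → c' ∈ B (i + 1) →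
        ∀ b : PBond (F.P K) i, (blockOf b.src = c'.src ∨ blockOf b.src = c'.tgt) → b ∈ B i) ∧
      (∀ (i : ℕ) (c' : PBond (F.P K) (i + 1)), i + 1 ≤ j → c' ∈ B (i + 1) →
        ∃ xs : (l : ℕ) → Site (F.P K) l, xs i = emb c'.src ∧ (∀ l, l < i → xs l = emb (xs (l + 1))) ∧
          (↑(boxRegion (xs 0) ((F.P K).L ^ i * (2 * (F.P K).L + (((F.P K).d + 4) * (F.P K).L + 2)))) : Set (Plaq (F.P K) 0)) ⊆
            {q | ∃ j', j' ≤ kc ∧ j ≤ j' + 1 ∧ q ∈ plaqsOf (topSeq Ω₀ Ω j')})) :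
    ContinuousOn (fun (U : GaugeField (F.P K) 0 (SU N)) (i : Fin (constrCardB 𝔅 k)) =>
      ((avgFamily (avOfRecord F N K) U ((constrEnumB 𝔅 k).symm i).1 ((constrEnumB 𝔅 k).symm i).2.1 : SU N) : Matrix (Fin N) (Fin N) ℂ))
      (closure (regMSCoPOfRecordAt F N ν K kc Ω₀ Ω)) := by
  have hL0 : (0 : ℝ) < (F.P K).L := by exact_mod_cast (F.P K).L_pos
  have hα : 0 < 2 * ((F.P K).L : ℝ) ^ 2 * ν.εreg := by positivity
  refine continuousOn_constrainedAverages_of_towerGuards hk 𝔅 _ fun U₀ hU₀ j hj c hc => ?_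
  obtain ⟨B, hcB, hB, hbox⟩ := hgeom j hj c hc
  refine ⟨B, hcB, hB, fun i c' hi hc' => ?_⟩
  obtain ⟨xs, hxi, hxs, hsub⟩ := hbox i c' hi hc'
  refine small_iter_of_plaqSmallOn_coneBox ((hi.trans hj).trans hk) c' xs hxi hxs hα hα3 hα2 fun q hq => ?_
  have h := plaqSmallOn_of_mem_closure_regMSCoPOfRecordAt_of_subset_levels hε hU₀ hsub q hq
  have hη : (F.P K).eta j ^ 2 ≤ (F.P K).eta i ^ 2 := by
    have h0 : (0 : ℝ) ≤ (F.P K).eta j := by unfold Params.eta; positivity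
    exact pow_le_pow_left₀ h0 (eta_le_eta_of_le (F := F) (K := K) (by omega)) 2
  exact h.trans_le (mul_le_mul_of_nonneg_left hη hα.le)

end

section
variable {F : T4Family} {N : ℕ} [NeZero N] {K : ℕ}

/-- ★★★ **THE SAME AT THE SUPPORT OF RECORD** (`regMSCoPOfRecord`), cone-box packaging. [cite: Balaban1985Variational, (2), (6)–(7) pp.278–279; Balaban1988Convergent, p.255, (2.12)–(2.13) pp.256–257; Balaban1985Averaging, Prop. 2 (52)–(54) p.26] -/
theorem continuousOn_constrainedAverages_closure_regMSCoPOfRecord_of_coneBoxes (ν : Stage7Numerics) (hε : 0 < ν.εreg) {k : ℕ}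
    (hk : k ≤ (F.P K).m + (F.P K).K) (kc : ℕ) (Ω : ℕ → Set (Site (F.P K) 0)) (𝔅 : BDetSet (F.P K))
    (hα3 : (143 * (((((F.P K).d + 4 : ℕ) : ℝ)) ^ 2 / 4) ^ 2) * (2 * ((F.P K).L : ℝ) ^ 2 * ν.εreg) ≤ 1 / 3)
    (hα2 : 2 * (2 * ((F.P K).L : ℝ) ^ 2 * ν.εreg) ≤ 2 * deltaSU (Fin N) / ((((F.P K).d + 4) * (F.P K).L : ℕ) : ℝ) ^ 2)
    (hgeom : ∀ j, j ≤ k → ∀ c ∈ (𝔅 j), ∃ B : (i : ℕ) → Set (PBond (F.P K) i), c ∈ B j ∧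
      (∀ (i : ℕ) (c' : PBond (F.P K) (i + 1)), i + 1 ≤ j → c' ∈ B (i + 1) →
        ∀ b : PBond (F.P K) i, (blockOf b.src = c'.src ∨ blockOf b.src = c'.tgt) → b ∈ B i) ∧
      (∀ (i : ℕ) (c' : PBond (F.P K) (i + 1)), i + 1 ≤ j → c' ∈ B (i + 1) →
        ∃ xs : (l : ℕ) → Site (F.P K) l, xs i = emb c'.src ∧ (∀ l, l < i → xs l = emb (xs (l + 1))) ∧
          (↑(boxRegion (xs 0) ((F.P K).L ^ i * (2 * (F.P K).L + (((F.P K).d + 4) * (F.P K).L + 2)))) : Set (Plaq (F.P K) 0)) ⊆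
            {q | ∃ j', j' ≤ kc ∧ j ≤ j' + 1 ∧ q ∈ plaqsOf (topSeq (suppDomOfRecord F ν K Ω) Ω j')})) :
    ContinuousOn (fun (U : GaugeField (F.P K) 0 (SU N)) (i : Fin (constrCardB 𝔅 k)) =>
      ((avgFamily (avOfRecord F N K) U ((constrEnumB 𝔅 k).symm i).1 ((constrEnumB 𝔅 k).symm i).2.1 : SU N) : Matrix (Fin N) (Fin N) ℂ))
      (closure (regMSCoPOfRecord F N ν K kc Ω)) :=
  continuousOn_constrainedAverages_closure_regMSCoPOfRecordAt_of_coneBoxes ν hε hk kc (suppDomOfRecord F ν K Ω) Ω 𝔅 hα3 hα2 hgeom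

end

section
variable {F : T4Family} {N : ℕ} [NeZero N] {K : ℕ}

/-- ★★★ **THE THREE CLASS LETTERS OF E″∕I AT `reg' := closure (regMSCoPOfRecord …)`, CONE-BOX PACKAGING.**
[cite: Balaban1985Variational, Thm 1 p.279, (2), (6)–(7) pp.278–279, (16)–(18) p.280; Balaban1988Convergent, (2.12)–(2.13) pp.256–257; Balaban1985Averaging, Prop. 2 (52)–(54) p.26] -/
theorem classLetters_closure_regMSCoPOfRecord_of_coneBoxes (ν : Stage7Numerics) (hε : 0 < ν.εreg) {k : ℕ} (hk : k ≤ (F.P K).m + (F.P K).K)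
    (kc : ℕ) (Ω : ℕ → Set (Site (F.P K) 0)) (𝔅 : BDetSet (F.P K))
    (hα3 : (143 * (((((F.P K).d + 4 : ℕ) : ℝ)) ^ 2 / 4) ^ 2) * (2 * ((F.P K).L : ℝ) ^ 2 * ν.εreg) ≤ 1 / 3)
    (hα2 : 2 * (2 * ((F.P K).L : ℝ) ^ 2 * ν.εreg) ≤ 2 * deltaSU (Fin N) / ((((F.P K).d + 4) * (F.P K).L : ℕ) : ℝ) ^ 2)
    (hgeom : ∀ j, j ≤ k → ∀ c ∈ (𝔅 j), ∃ B : (i : ℕ) → Set (PBond (F.P K) i), c ∈ B j ∧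
      (∀ (i : ℕ) (c' : PBond (F.P K) (i + 1)), i + 1 ≤ j → c' ∈ B (i + 1) →
        ∀ b : PBond (F.P K) i, (blockOf b.src = c'.src ∨ blockOf b.src = c'.tgt) → b ∈ B i) ∧
      (∀ (i : ℕ) (c' : PBond (F.P K) (i + 1)), i + 1 ≤ j → c' ∈ B (i + 1) →
        ∃ xs : (l : ℕ) → Site (F.P K) l, xs i = emb c'.src ∧ (∀ l, l < i → xs l = emb (xs (l + 1))) ∧
          (↑(boxRegion (xs 0) ((F.P K).L ^ i * (2 * (F.P K).L + (((F.P K).d + 4) * (F.P K).L + 2)))) : Set (Plaq (F.P K) 0)) ⊆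
            {q | ∃ j', j' ≤ kc ∧ j ≤ j' + 1 ∧ q ∈ plaqsOf (topSeq (suppDomOfRecord F ν K Ω) Ω j')})) :
    IsClosed (closure (regMSCoPOfRecord F N ν K kc Ω)) ∧
      closure (regMSCoPOfRecord F N ν K kc Ω) ⊆ closure (regMSCoPOfRecord F N ν K kc Ω) ∧
      ContinuousOn (fun (U : GaugeField (F.P K) 0 (SU N)) (i : Fin (constrCardB 𝔅 k)) =>
        ((avgFamily (avOfRecord F N K) U ((constrEnumB 𝔅 k).symm i).1 ((constrEnumB 𝔅 k).symm i).2.1 : SU N) : Matrix (Fin N) (Fin N) ℂ))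
        (closure (regMSCoPOfRecord F N ν K kc Ω)) :=
  ⟨isClosed_closure, subset_rfl, continuousOn_constrainedAverages_closure_regMSCoPOfRecord_of_coneBoxes ν hε hk kc Ω 𝔅 hα3 hα2 hgeom⟩

end

end Summit.QuantumFields.YangMills.BalabanUVNodes.N12ClassLettersAtClosedClassOfRecordB

end
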